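import Summits.QuantumFields.YangMills.Theorems.BalabanUVNodesK0AxCtabUniq
import Summits.QuantumFields.YangMills.Theorems.BalabanUVNodesK0AxRowLTRec
import Summits.QuantumFields.YangMills.Theorems.BalabanUVNodesPortU8TwoVolumeRowB

/-!
# K0ᴬ — NODE v8.3 ROW (C): (bk-3) THE 𝐉-ROWS OF (C-tab) — «the linearised (1.8) current KILLS lattice gradients» — and ★★★ `tableRowLT_of_weaklyCritical`:
# (C-tab) `TableRowLT F θ k K a` FROM the (C-tab-opt) receipt `RootedResponseWeaklyCriticalAt` AND TokP9reg (the rooted entries analytic at `0` — P0-HypAn), nothing else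

Cell `ym-nodeO-ideate` ∕ `ym-balaban-port`, porter `ymgap-nodeO-port-PTB-1` (gen 4).  JOIN-side helper for **stmt-QuantumFields-27238** (K0ᴬ), `--supports … --as helper`.
◆ CRIT-1 g35 (CUT №4′ 06:50:07Z): «row (C) now = (C-tab-opt) [OPEN·M mod P0] ⊕ (bk-3) 𝐉-rows [S] only» after ◇ lens-1's v8.3 closed (bk-1)(bk-2) (✓`K0AxCtabUniq.recordHr_sub_recordHrLocξ_univ_of_weaklyCritical`,
✓`tableRowLT_urows_of_weaklyCritical`).  THIS FILE CLOSES (bk-3) and assembles (C-tab).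
[I] = [Balaban1987RG1], [15] = [Balaban1985Variational], [B6] = [Balaban1984PropagatorsII], [B9] = [Balaban1985BackgroundPropagators].

WHAT IS PROVED (kernel, sorry-free; at the fill `θ := thetaFill F a₀ ε₂₉`, `0 < a₀`, standing range).
§1 `stencil_eq_of_sub_grad` — the (1.8) `d*d`-stencil of two matrix-valued bond fields that differ by a lattice gradient AGREE (✓`curlF_of_exact`, twice differenced).
§2 ★★ `recordGkL_inr_eq_recordGkLocWξ_univ_inr` — THE 𝐉-ROWS: under TokP9reg at `(k, K)` (entries of `recordBgField` analytic at `0`) and the receipt `RootedResponseWeaklyCriticalAt … a l`,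
   `recordGkL … a l (b, 𝐉, c) = recordGkLocWξ … Finset.univ a l (b, 𝐉, c)` for EVERY bond `b` and colour `c`: the rooted 𝐉-block is the linearised current of `U′δ = Matrix.of ∘ recordD`
   (✓`recordGkJ_inr_eq`, port M), `recordD = recordHr + dφ_L` (✓`recordD_eq_recordHr_add`), `recordHr = recordHrLocξ univ + dΨ` (the receipt through ✓v8.3), the stencil kills both
   gradients (§1), and the transverse 𝐉-block is the same stencil in CLOSED FORM (✓`recordJLocξ_eq`, ✓`recordGkLocWξ_inr`).
§3 ★★★ `tableRowLT_of_weaklyCritical` — (C-tab): `TableRowLT F θ k K a` from TokP9reg at `(k, K)` and the receipt at every label (𝐔-rows ✓`tableRowLT_urows_of_weaklyCritical`, 𝐉-rows §2,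
   `recordGradLeg φ` vanishing on 𝐉-coordinates by definition).

HONEST FRAMING.  Lattice calculus + chain rule; the receipt (C-tab-opt) (= [15] (178) linearised, first-order optimality of the rooted response) and TokP9reg (P0-HypAn) are DISPLAYED
hypotheses — (C-tab) is therefore IN THE TREE MODULO P0 exactly as ◆ labelled; nothing of Bałaban's analysis asserted∕ported∕discharged; K0ᴬ 27238 OPEN; NODE O 0∕1; COUNT 8∕28 ·
K 1∕4 UNMOVED; finite `𝕋⁴_{L^K}` at fixed ε — NOT continuum ∕ OS ∕ Clay; **the Yang–Mills mass gap (Clay) is NOT proved by any of this.**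
-/

noncomputable section

open scoped BigOperators Matrix.Norms.L2Operator
open Complex (I)

namespace Summit.QuantumFields.YangMills.Theorems.K0AxCtabUniq

open Literature.MathematicalPhysics.QuantumFieldTheory.Balaban1983to89
open Literature.MathematicalPhysics.QuantumFieldTheory.Balaban1983to89.Node00
open Literature.MathematicalPhysics.QuantumFieldTheory.Balaban1983to89.T4Continuum (T4Family)
open Literature.MathematicalPhysics.QuantumFieldTheory.Balaban1983to89.B6SectAOperatorsV1 (dE dE_apply)
open Summit.QuantumFields.YangMills.Theorems.K0RecordFormatNames
open Summit.QuantumFields.YangMills.Theorems.K0AxGaugeFlowRec (recordGradLeg)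
open Summit.QuantumFields.YangMills.Theorems.K0AxRowLTRec (TableRowLT)
open Summit.QuantumFields.YangMills.Theorems.PortU8

variable (F : T4Family)

/-! ## §1  The `d*d`-stencil kills lattice gradients -/

/-- **THE (1.8) STENCIL OF TWO BOND FIELDS DIFFERING BY A LATTICE GRADIENT AGREE**: if `D b = H b + (φ b₋ − φ (b₋ + e_{μ_b}))` bondwise, the twice-differenced curl stencil
`Σ_ν [(D(x,μ) + D(x+e_μ,ν) − D(x+e_ν,μ) − D(x,ν)) − (same at x − e_ν)]` of `D` equals that of `H` (✓`curlF_of_exact` on each plaquette). [cite: Balaban1985BackgroundPropagators, (3.4) p.391; Balaban1987RG1, (1.8) p.261 (bookkeeping)] -/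
theorem stencil_eq_of_sub_grad {P : Params} {V : Type*} [AddCommGroup V] {D H : PBond P 0 → V} {φ : Site P 0 → V}
    (hD : ∀ b : PBond P 0, D b = H b + (φ b.src - φ (b.src.shift b.dir))) (b : PBond P 0) :
    ∑ ν : Fin P.d, ((D ⟨b.src, b.dir⟩ + D ⟨b.src.shift b.dir, ν⟩ - D ⟨b.src.shift ν, b.dir⟩ - D ⟨b.src, ν⟩) -
        (D ⟨b.src.unshift ν, b.dir⟩ + D ⟨(b.src.unshift ν).shift b.dir, ν⟩ - D ⟨(b.src.unshift ν).shift ν, b.dir⟩ - D ⟨b.src.unshift ν, ν⟩)) =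
      ∑ ν : Fin P.d, ((H ⟨b.src, b.dir⟩ + H ⟨b.src.shift b.dir, ν⟩ - H ⟨b.src.shift ν, b.dir⟩ - H ⟨b.src, ν⟩) -
        (H ⟨b.src.unshift ν, b.dir⟩ + H ⟨(b.src.unshift ν).shift b.dir, ν⟩ - H ⟨(b.src.unshift ν).shift ν, b.dir⟩ - H ⟨b.src.unshift ν, ν⟩)) := by
  refine Finset.sum_congr rfl fun ν _ => ?_
  rw [curlF_of_exact hD b.src b.dir ν, curlF_of_exact hD (b.src.unshift ν) b.dir ν]

/-! ## §2  ★★ The 𝐉-rows of (C-tab): rooted and transverse 𝐉-blocks AGREE (mod TokP9reg + the receipt) -/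

/-- ★★ **THE 𝐉-ROWS**: under TokP9reg at `(k, K)` and the receipt `RootedResponseWeaklyCriticalAt … a l`, for every bond `b` and 𝔰𝔩₂-colour `c`,
`recordGkL … a l (b, 𝐉, c) = recordGkLocWξ … Finset.univ a l (b, 𝐉, c)` — the linearised current reads `recordD = recordHrLocξ univ + (gradients)` and kills the gradients.
[cite: Balaban1987RG1, (1.8) p.261, (4.35) p.290; Balaban1985Variational, (21) p.281, (178) p.306, (182) p.307; Balaban1984PropagatorsII, (2.35) p.228] -/
theorem recordGkL_inr_eq_recordGkLocWξ_univ_inr (a₀ ε₂₉ : ℝ) (ha₀ : 0 < a₀) (k K : ℕ) (hk : k + 1 ≤ (F.P K).m + (F.P K).K)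
    (hreg : letI θ := thetaFill F a₀ ε₂₉; letI := θ.instVβ₁; letI := θ.instVβ₂; letI := θ.instιβ;
      AnalyticAt ℝ (fun B : recordW F a₀ ε₂₉ k K => fun (b : PBond (F.P K) 0) (i i' : Fin 2) => ((recordBgField F θ k K B b : SU 2) : Matrix (Fin 2) (Fin 2) ℂ) i i') 0)
    (a : (thetaFill F a₀ ε₂₉).ιβ) (l : RespLabel F k K) (h : RootedResponseWeaklyCriticalAt F (thetaFill F a₀ ε₂₉) k K a l)
    (b : PBond (F.P K) 0) (c : Fin 3) :
    recordGkL F (thetaFill F a₀ ε₂₉) k K a l (chartEquivJ F K (b, Sum.inr c)) =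
      recordGkLocWξ F (thetaFill F a₀ ε₂₉) k K Finset.univ a l (chartEquivJ F K (b, Sum.inr c)) := by
  classical
  letI θ := thetaFill F a₀ ε₂₉; letI := θ.instVβ₁; letI := θ.instVβ₂; letI := θ.instιβ
  have hkK : k + 1 ≤ (F.P K).m + (F.P K).K := hk
  -- TokP9reg: the rooted field's derivative `U′` with `U′δ = Matrix.of ∘ recordD`, and `ι` differentiable
  have hd2 : ContDiffAt ℝ 2 (fun B : recordW F a₀ ε₂₉ k K => fun (b : PBond (F.P K) 0) (i i' : Fin 2) =>
      ((recordBgField F θ k K B b : SU 2) : Matrix (Fin 2) (Fin 2) ℂ) i i') 0 := hreg.contDiffAt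
  obtain ⟨U', hU'eq, hU'⟩ := hasFDerivAt_bgField_of_entries F θ k K (hd2.differentiableAt (by norm_num))
  have hE : DifferentiableAt ℝ (recordEmbJ F θ k K) 0 :=
    (contDiffAt_recordEmbJ_of F θ k K hkK ha₀ (contDiffAt_matrix_of_entries hd2)).differentiableAt (by norm_num)
  rw [recordGkL_inr, recordGkJ_inr_eq F θ k K hkK ha₀ U' hU' hE a l b c, recordGkLocWξ_inr, recordJLocξ_eq]
  congr 3
  -- `U′δ = Matrix.of ∘ recordD = Matrix.of ∘ recordHr + dφ_L = Matrix.of ∘ recordHrLocξ univ + dΨ + dφ_L`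
  have hUD : ∀ β : PBond (F.P K) 0, U' (Pi.single l.1 (Pi.single l.2 (θ.bV a))) β = Matrix.of (recordD F θ k K a l β) := fun β => hU'eq _ β
  obtain ⟨Ψre, Ψim, hΨ⟩ := recordHr_sub_recordHrLocξ_univ_of_weaklyCritical F θ k K hk a l h
  -- the two potentials, matrix-valued
  set φL : Site (F.P K) 0 → MatA 2 := fun x => -Matrix.of (fun i i' => landauPotC F k K (fun b' => recordD F θ k K a l b' i i') x) with hφL
  set φΨ : Site (F.P K) 0 → MatA 2 := fun x => -Matrix.of (fun i i' => ((WithLp.ofLp (Ψre i i') x : ℝ) : ℂ) + ((WithLp.ofLp (Ψim i i') x : ℝ) : ℂ) * Complex.I) with hφΨ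
  have hsplit : ∀ β : PBond (F.P K) 0, U' (Pi.single l.1 (Pi.single l.2 (θ.bV a))) β =
      (Matrix.of fun i i' => recordHrLocξ F θ k K Finset.univ a l β i i' : MatA 2) + ((φL + φΨ) β.src - (φL + φΨ) (β.src.shift β.dir)) := by
    intro β
    rw [hUD]
    ext i i'
    have h1 := recordD_eq_recordHr_add F θ k K a l β i i'
    have h2 := hΨ β i i'
    simp only [Matrix.add_apply, Matrix.sub_apply, Matrix.of_apply, Pi.add_apply, hφL, hφΨ, Matrix.neg_apply, dE_apply,
      LatticeFieldCalculus.grad, one_smul, PBond.tgt, Complex.ofReal_sub] at h1 h2 ⊢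
    linear_combination h1 + h2
  rw [stencil_eq_of_sub_grad hsplit b]

/-! ## §3  ★★★ (C-tab) from the receipt and TokP9reg -/

/-- ★★★ **(C-tab) `TableRowLT F θ k K a` FROM THE (C-tab-opt) RECEIPT AND TokP9reg**: for every label `l` there is ONE potential `φ` (the 𝔰𝔩₂-coordinates of `−(Ψ + φ_L)`'s
rooted-minus-transverse gradient) with `recordGkL … a l i − recordGkLocWξ … univ a l i = recordGradLeg F K φ i` for EVERY two-block coordinate `i` — 𝐔-rows by ✓v8.3
`tableRowLT_urows_of_weaklyCritical`, 𝐉-rows by §2 (both sides agree; `recordGradLeg φ` vanishes there).  Row (C) of NODE v8 is thereby IN THE TREE MODULO its two displayed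
hypotheses (the receipt = [15] (178) at the flat point, and P0-HypAn). [cite: Balaban1985Variational, (178) p.306, (21) p.281, Prop. 9 p.309; Balaban1987RG1, (4.8) p.283, (4.35) p.290, (1.8) p.261; Balaban1984PropagatorsII, (2.35) p.228] -/
theorem tableRowLT_of_weaklyCritical (a₀ ε₂₉ : ℝ) (ha₀ : 0 < a₀) (k K : ℕ) (hk : k + 1 ≤ (F.P K).m + (F.P K).K)
    (hreg : letI θ := thetaFill F a₀ ε₂₉; letI := θ.instVβ₁; letI := θ.instVβ₂; letI := θ.instιβ;
      AnalyticAt ℝ (fun B : recordW F a₀ ε₂₉ k K => fun (b : PBond (F.P K) 0) (i i' : Fin 2) => ((recordBgField F θ k K B b : SU 2) : Matrix (Fin 2) (Fin 2) ℂ) i i') 0)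
    (a : (thetaFill F a₀ ε₂₉).ιβ) (h : ∀ l : RespLabel F k K, RootedResponseWeaklyCriticalAt F (thetaFill F a₀ ε₂₉) k K a l) :
    TableRowLT F (thetaFill F a₀ ε₂₉) k K a := by
  intro l
  obtain ⟨φ, hφ⟩ := tableRowLT_urows_of_weaklyCritical F (thetaFill F a₀ ε₂₉) k K hk a l (h l)
  refine ⟨φ, fun i => ?_⟩
  obtain ⟨⟨b, t⟩, rfl⟩ := (chartEquivJ F K).surjective i
  rcases t with c | c
  · exact hφ b c
  · rw [recordGkL_inr_eq_recordGkLocWξ_univ_inr F a₀ ε₂₉ ha₀ k K hk hreg a l (h l) b c, sub_self]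
    simp [recordGradLeg]

end Summit.QuantumFields.YangMills.Theorems.K0AxCtabUniq

end
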